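import Literature.Geometry.Riemannian.RicciFlowScalarCurvature
import Literature.Geometry.Lorentzian.MetricNormSq
import Mathlib.Algebra.Order.Chebyshev
import Mathlib.Analysis.Calculus.Deriv.Inv
import Mathlib.Topology.VectorBundle.FiniteDimensional
import HarnessLib

/-!
# Elementary inputs of Topping's scalar-curvature minimum principle (Thm. 3.2.1)
(topic `Geometry/Riemannian`)

Companion of `RicciFlowScalarCurvature.lean` / `RicciFlowScalarCurvatureHolds.lean`. The named
fact `Literature.Geometry.Riemannian.ricciFlow_scalarCurvature_lowerBound` (Topping 2006,
Thm. 3.2.1: along a Ricci flow on a closed manifold, `R ≥ α` at `t = 0` gives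
`R ≥ α/(1 - (2α/n)t)`) is, in print, the weak minimum principle (Topping, Cor. 3.1.2 of
Thm. 3.1.1) applied to the differential inequality

  `∂R/∂t ≥ ΔR + (2/n) R²`                                     (Topping, Cor. 2.5.5, (2.5.6))

with the comparison function `φ(t) = α/(1 - (2α/n)t)` solving `φ' = (2/n) φ²`, `φ(0) = α`.
Cor. 2.5.5 is the evolution equation `∂R/∂t = ΔR + 2|Ric|²` (Topping, Prop. 2.5.4; Hamilton 1982,
Cor. 7.5) combined with the pointwise inequality `|Ric|² ≥ R²/n` ("by making the orthogonal
decomposition `Ric = Ric° + (R/n) g` … `|Ric|² = |Ric°|² + R²/n ≥ R²/n`", Topping, p. 33).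
Since `RicciFlowScalarCurvatureHolds.lean` proves Cor. 3.2.4 (`ricciFlow_singularTime_le`) from
Thm. 3.2.1, discharging Thm. 3.2.1 discharges both. This file PROVES the two elementary,
dimension-free inputs of that argument; what remains are the analytic ones (the evolution
equation of `R`, Prop. 2.5.4, which needs the variation of the Levi-Civita connection and of its
curvature and the contracted second Bianchi identity, and the weak maximum principle,
Thm. 3.1.1, which needs `Δu ≤ 0`, `∇u = 0` at a spatial maximum).

## Contents (all proved)

* `PseudoRiemannianMetric.trace_eq_sum_div_of_isOrthoᵢ` — the metric trace in a `g_b`-orthogonal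
  basis of non-null vectors: `tr_g T = ∑ᵢ T(eᵢ, eᵢ) / g(eᵢ, eᵢ)` (O'Neill 1983, Ch. 3, pp. 60–61,
  Lemma 3.36), bundle level, any signature.
* `PseudoRiemannianMetric.trace_sq_le_finrank_mul_normSq` — **`(tr_g T)² ≤ n |T|²_g`** for a
  Riemannian metric and every bilinear form `T` on a fibre, `n` the rank (Cauchy–Schwarz in an
  orthogonal frame, via `normSq_eq_sum_sq` of `MetricNormSq.lean`); for `T = Ric` this is
  Topping's `|Ric|² ≥ R²/n`.
* `scalarCurvatureWith_sq_le_finrank_mul_normSq_ricci` — the tangent-bundle instance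
  `R² ≤ n |Ric|²_g` for the pair `(g, cov)` (`R = scalarCurvatureWith g cov x`), and
  `two_mul_normSq_ricci_ge` : `2|Ric|² ≥ (2/n) R²`, the form in which it turns Prop. 2.5.4 into
  Cor. 2.5.5.
* `hasDerivAt_comparison_toppingThm321` — the comparison function `φ(t) = α/(1 - (2α/n)t)` has
  `φ'(t) = (2/n) φ(t)²` wherever `1 - (2α/n)t ≠ 0`, and `φ(0) = α`
  (`comparison_toppingThm321_zero`).

## References

* P. Topping, *Lectures on the Ricci flow*, LMS Lecture Note Series 325, Cambridge Univ. Press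
  2006: §2.5, Prop. 2.5.4 and Cor. 2.5.5 (p. 33), §3.1, Thm. 3.1.1 / Cor. 3.1.2, §3.2,
  Thm. 3.2.1 (p. 36). [Topping2006]
* R. S. Hamilton, *Three-manifolds with positive Ricci curvature*, J. Differential Geom. 17
  (1982), §7, Cor. 7.5 (p. 276). [Hamilton1982]
* B. O'Neill, *Semi-Riemannian geometry*, Academic Press 1983, Ch. 3, pp. 60–61, Lemma 3.36.
  [ONeill1983]
-/

noncomputable section

open Bundle Set Module Finset
open scoped Manifold ContDiff Topology BigOperators

namespace Literature.Geometry.Lorentzian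

namespace PseudoRiemannianMetric

/-! ### The metric trace in an orthogonal frame and the Cauchy–Schwarz bound `(tr T)² ≤ n |T|²` -/

section Bundle

variable
  {EB : Type*} [NormedAddCommGroup EB] [NormedSpace ℝ EB]
  {HB : Type*} [TopologicalSpace HB] {IB : ModelWithCorners ℝ EB HB} {n : ℕ∞ω}
  {B : Type*} [TopologicalSpace B] [ChartedSpace HB B]
  {F : Type*} [NormedAddCommGroup F] [NormedSpace ℝ F] [FiniteDimensional ℝ F]
  {E : B → Type*} [TopologicalSpace (TotalSpace F E)]
  [∀ b, TopologicalSpace (E b)] [∀ b, AddCommGroup (E b)] [∀ b, Module ℝ (E b)]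
  [FiberBundle F E] [VectorBundle ℝ F E]
  (g : PseudoRiemannianMetric IB n F E) (b : B)

/-- **The metric trace in an orthogonal frame.** In a `g_b`-orthogonal basis `e` of the fibre
consisting of non-null vectors, `tr_g T = ∑ᵢ T(eᵢ, eᵢ) / g(eᵢ, eᵢ)` — the index formula
`g^{ij} T_{ij}` with `g^{ii} = 1/g(eᵢ, eᵢ)` (O'Neill 1983, Ch. 3, pp. 60–61 and Lemma 3.36,
metric contraction relative to a frame; here unnormalised, any signature). The coordinates in an
orthogonal basis are `repr_eq_div_of_isOrthoᵢ` (`MetricNormSq.lean`) and `g(♯α, w) = α w`.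
[cite: ONeill1983, Ch. 3, pp. 60–61] -/
theorem trace_eq_sum_div_of_isOrthoᵢ {ι : Type*} [Fintype ι] [DecidableEq ι]
    (e : Basis ι ℝ (E b)) (he : (g.toBilinForm b).IsOrthoᵢ e)
    (hc : ∀ i, g.val b (e i) (e i) ≠ 0) (T : LinearMap.BilinForm ℝ (E b)) :
    g.trace b T = ∑ i, T (e i) (e i) / g.val b (e i) (e i) := by
  classical
  rw [PseudoRiemannianMetric.trace, LinearMap.trace_eq_matrix_trace ℝ e, Matrix.trace]
  refine Finset.sum_congr rfl fun i _ ↦ ?_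
  rw [Matrix.diag_apply, LinearMap.toMatrix_apply, repr_eq_div_of_isOrthoᵢ e he hc,
    LinearMap.comp_apply]
  simp

/-- **Cauchy–Schwarz for the metric contraction: `(tr_g T)² ≤ n · |T|²_g`** for a Riemannian
metric `g` (on a bundle of rank `n = finrank ℝ F`) and every bilinear form `T` on a fibre. In a
`g_b`-orthogonal frame (`exists_isOrthoᵢ_basis`), `tr_g T = ∑ᵢ Tᵢᵢ/gᵢᵢ`
(`trace_eq_sum_div_of_isOrthoᵢ`) and `|T|²_g = ∑ᵢⱼ Tⱼᵢ²/(gᵢᵢ gⱼⱼ) ≥ ∑ᵢ (Tᵢᵢ/gᵢᵢ)²`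
(`normSq_eq_sum_sq`, all terms nonnegative as `gᵢᵢ > 0`), so the claim is
`(∑ᵢ aᵢ)² ≤ n ∑ᵢ aᵢ²`. For `T = Ric` this is the inequality `|Ric|² ≥ R²/n` by which Topping
passes from Prop. 2.5.4 to Cor. 2.5.5 (p. 33: orthogonal decomposition
`Ric = Ric° + (R/n) g`, `|Ric|² = |Ric°|² + R²/n`). [cite: Topping2006, §2.5, Cor. 2.5.5 (p. 33)] -/
theorem trace_sq_le_finrank_mul_normSq (hg : g.IsRiemannian) (T : LinearMap.BilinForm ℝ (E b)) :
    g.trace b T ^ 2 ≤ finrank ℝ F * g.normSq b T := by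
  classical
  obtain ⟨e, he, -⟩ := g.exists_isOrthoᵢ_basis b
  have hpos : ∀ i, 0 < g.val b (e i) (e i) := fun i ↦ hg b (e i) (e.ne_zero i)
  have hc : ∀ i, g.val b (e i) (e i) ≠ 0 := fun i ↦ (hpos i).ne'
  rw [g.trace_eq_sum_div_of_isOrthoᵢ b e he hc T, g.normSq_eq_sum_sq b e he hc T]
  have hcard : ((Finset.univ : Finset (Fin (finrank ℝ (E b)))).card : ℝ) = finrank ℝ F := by
    rw [Finset.card_univ, Fintype.card_fin, VectorBundle.finrank_eq ℝ F E b]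
  calc (∑ i, T (e i) (e i) / g.val b (e i) (e i)) ^ 2
      ≤ (Finset.univ : Finset (Fin (finrank ℝ (E b)))).card *
          ∑ i, (T (e i) (e i) / g.val b (e i) (e i)) ^ 2 := sq_sum_le_card_mul_sum_sq
    _ ≤ (Finset.univ : Finset (Fin (finrank ℝ (E b)))).card *
          ∑ i, ∑ j, T (e j) (e i) ^ 2 / (g.val b (e i) (e i) * g.val b (e j) (e j)) := by
        gcongr with i _
        have hterm : ∀ j, 0 ≤ T (e j) (e i) ^ 2 / (g.val b (e i) (e i) * g.val b (e j) (e j)) :=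
          fun j ↦ div_nonneg (sq_nonneg _) (mul_pos (hpos i) (hpos j)).le
        calc (T (e i) (e i) / g.val b (e i) (e i)) ^ 2
            = T (e i) (e i) ^ 2 / (g.val b (e i) (e i) * g.val b (e i) (e i)) := by
              rw [div_pow, sq (g.val b (e i) (e i))]
          _ ≤ ∑ j, T (e j) (e i) ^ 2 / (g.val b (e i) (e i) * g.val b (e j) (e j)) :=
              Finset.single_le_sum (f := fun j ↦
                T (e j) (e i) ^ 2 / (g.val b (e i) (e i) * g.val b (e j) (e j)))
                (fun j _ ↦ hterm j) (Finset.mem_univ i)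
    _ = finrank ℝ F * ∑ i, ∑ j, T (e j) (e i) ^ 2 / (g.val b (e i) (e i) * g.val b (e j) (e j)) := by
        rw [hcard]

/-- `|T|²_g ≥ (tr_g T)² / n` — the same bound in quotient form (for rank `n = 0` both sides
vanish trivially / by Lean's `x / 0 = 0`). [cite: Topping2006, §2.5, Cor. 2.5.5 (p. 33)] -/
theorem trace_sq_div_finrank_le_normSq (hg : g.IsRiemannian) (T : LinearMap.BilinForm ℝ (E b)) :
    g.trace b T ^ 2 / finrank ℝ F ≤ g.normSq b T := by
  rcases Nat.eq_zero_or_pos (finrank ℝ F) with h0 | hpos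
  · rw [h0, Nat.cast_zero, div_zero]
    exact g.normSq_nonneg b hg T
  · rw [div_le_iff₀ (by exact_mod_cast hpos)]
    calc g.trace b T ^ 2 ≤ finrank ℝ F * g.normSq b T := g.trace_sq_le_finrank_mul_normSq b hg T
      _ = g.normSq b T * finrank ℝ F := mul_comm _ _

end Bundle

end PseudoRiemannianMetric

end Literature.Geometry.Lorentzian

namespace Literature.Geometry.Riemannian

open Lorentzian Lorentzian.PseudoRiemannianMetric

/-! ### `|Ric|² ≥ R²/n` for the pair `(g, cov)` (Topping, p. 33) -/

section Tangent

variable {E : Type*} [NormedAddCommGroup E] [NormedSpace ℝ E] {H : Type*} [TopologicalSpace H]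
  {I : ModelWithCorners ℝ E H} {M : Type*} [TopologicalSpace M] [ChartedSpace H M]
  [IsManifold I ∞ M] {n : ℕ∞ω} [FiniteDimensional ℝ E]
  (g : PseudoRiemannianMetric I n E (TangentSpace I : M → Type _))
  (cov : CovariantDerivative I E (TangentSpace I : M → Type _)) (x : M)

/-- **`R² ≤ n |Ric|²_g`** for a Riemannian metric `g` on an `n`-manifold (`n = finrank ℝ E`) and
the Ricci tensor of any covariant derivative `cov` on `TM`, `R = tr_g Ric(cov)`
(`scalarCurvatureWith`): the case `T = Ric(cov)_x` of `trace_sq_le_finrank_mul_normSq`. Topping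
2006, p. 33: `|Ric|² = |Ric°|² + R²/n ≥ R²/n`. [cite: Topping2006, §2.5, Cor. 2.5.5 (p. 33)] -/
theorem scalarCurvatureWith_sq_le_finrank_mul_normSq_ricci (hg : g.IsRiemannian) :
    g.scalarCurvatureWith cov x ^ 2 ≤ finrank ℝ E * g.normSq x (cov.ricci x) :=
  g.trace_sq_le_finrank_mul_normSq x hg (cov.ricci x)

/-- **From Prop. 2.5.4 to Cor. 2.5.5**: `2|Ric|²_g ≥ (2/n) R²` pointwise for a Riemannian metric,
so that `∂R/∂t = ΔR + 2|Ric|²` implies `∂R/∂t ≥ ΔR + (2/n)R²` (Topping 2006, (2.5.5)–(2.5.6)).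
[cite: Topping2006, §2.5, Cor. 2.5.5 (p. 33)] -/
theorem two_div_finrank_mul_scalarCurvatureWith_sq_le (hg : g.IsRiemannian) :
    2 / finrank ℝ E * g.scalarCurvatureWith cov x ^ 2 ≤ 2 * g.normSq x (cov.ricci x) := by
  have h := g.trace_sq_div_finrank_le_normSq x hg (cov.ricci x)
  have h' : 2 / finrank ℝ E * g.scalarCurvatureWith cov x ^ 2
      = 2 * (g.scalarCurvatureWith cov x ^ 2 / finrank ℝ E) := by ring
  rw [h']
  exact mul_le_mul_of_nonneg_left h zero_le_two

end Tangent

/-! ### The comparison function of Thm. 3.2.1 -/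

/-- **The comparison ODE of Topping's Thm. 3.2.1.** The function `φ(t) = α / (1 - (2α/n) t)`
satisfies `φ'(t) = (2/n) φ(t)²` at every `t` with `1 - (2α/n) t ≠ 0` — the solution of
`dφ/dt = F(φ, t)` with `F(r, t) = (2/n) r²`, `φ(0) = α`, fed into the weak minimum principle
(Topping 2006, proof of Thm. 3.2.1: "In this case, `φ(t) = α/(1 - (2α/n)t)`"). Here `n` is any
real parameter (the dimension in the application; for `n = 0` Lean's `2/0 = 0` makes both the
coefficient and the derivative vanish, consistently). [cite: Topping2006, Thm. 3.2.1 (proof)] -/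
theorem hasDerivAt_comparison_toppingThm321 (α n t : ℝ) (ht : 1 - 2 * α / n * t ≠ 0) :
    HasDerivAt (fun s : ℝ ↦ α / (1 - 2 * α / n * s))
      (2 / n * (α / (1 - 2 * α / n * t)) ^ 2) t := by
  have hden : HasDerivAt (fun s : ℝ ↦ 1 - 2 * α / n * s) (-(2 * α / n)) t := by
    simpa using ((hasDerivAt_id t).const_mul (2 * α / n)).const_sub 1
  have h : HasDerivAt (fun s : ℝ ↦ α / (1 - 2 * α / n * s))
      ((0 * (1 - 2 * α / n * t) - α * (-(2 * α / n))) / (1 - 2 * α / n * t) ^ 2) t :=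
    (hasDerivAt_const t α).div hden ht
  refine h.congr_deriv ?_
  rcases eq_or_ne n 0 with hn | hn
  · subst hn
    simp
  · field_simp
    ring

/-- The comparison function starts at `φ(0) = α`. [cite: Topping2006, Thm. 3.2.1 (proof)] -/
theorem comparison_toppingThm321_zero (α n : ℝ) : α / (1 - 2 * α / n * 0) = α := by
  simp

/-- On the time range of Thm. 3.2.1 / Cor. 3.2.4 the comparison function is well defined and at
least `α` when `α ≥ 0`: for `0 ≤ t` with `0 < 1 - (2α/n)t` one has `α ≤ α / (1 - (2α/n)t)`
(the denominator lies in `(0, 1]`). This is how Cor. 3.2.2 (`R ≥ α` is preserved) follows from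
Thm. 3.2.1 for `α ≥ 0`. [cite: Topping2006, Cor. 3.2.2] -/
theorem le_comparison_toppingThm321 {α n t : ℝ} (hα : 0 ≤ α) (hn : 0 ≤ n) (ht : 0 ≤ t)
    (hden : 0 < 1 - 2 * α / n * t) : α ≤ α / (1 - 2 * α / n * t) := by
  rw [le_div_iff₀ hden]
  have : 0 ≤ 2 * α / n * t := mul_nonneg (div_nonneg (by linarith) hn) ht
  nlinarith

end Literature.Geometry.Riemannian

end
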